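import Summits.BirchSwinnertonDyer.BirchSwinnertonDyer.Theorems.SignedBaseChangeAnticyclotomicEisensteinDivisibilityOfStubsAdmdefV23
import Summits.BirchSwinnertonDyer.BirchSwinnertonDyer.Theorems.SignedBaseChangeDefiniteAnchorDefs
import Summits.BirchSwinnertonDyer.BirchSwinnertonDyer.Theorems.GenusKolyvaginAtTwoCasselsTatePTcRealReadout
import Literature.NumberTheory.EllipticCurves.CasselsTateAlternating
import HarnessLib

/-! # Line `admdef` v24: the KERNEL CENSUS — the crux BY NAME from the FIVE v24 stub texts
# (cite ×15 · S1∣ at `p ∣ h_K` · (Anch)_FW BY NAME · (Anch)_¬FW = item 33118 BY NAME · (γ′)_NP,Z)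

Crux `AnticyclotomicEisensteinDivisibility` (stmt-BirchSwinnertonDyer-20727, route `SignedBaseChange`), line `admdef`, skeleton **v24** (LEAD bsd-line-sbc-p1
gen 31; tree `Cruxes/AnticyclotomicEisensteinDivisibility/Lines/admdef.lean`).  v24 = v23 with two COUNT-NEUTRAL re-keys: (1) the two anchor stubs BY NAME —
`stub_definiteAnchorFW : …Theorems.SignedBaseChangeDefiniteAnchorDefs.DefiniteAnchorFW` and `stub_definiteAnchorNFW : ….DefiniteAnchorNonFW` (p773583; the
latter is the registered signature of the route ITEM stmt-BirchSwinnertonDyer-33118 `DefiniteAnchorNonFW` filed by the pen bsd-ssimc-plan g40 under director-bsd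
(543)(a)/(567)(A2)/(572); bodies = the v23 texts VERBATIM, `Iff.rfl`); (2) the Cassels–Tate conjunct of the cite stub DROPPED (16 → 15 named print facts) because
it is a TREE THEOREM (`WeierstrassCurve.exists_casselsTate_pairing_holds`; here re-derived route-independently from
`GenusExact.CasselsTatePTcReal.exists_casselsTate_pairing_of_levelThetaDatum` + `levelThetaDatumEven`, as `Theorems/KolyvaginRankRigidityAtTwoStartFrameOfParity`
does).  THIS FILE: **the crux BY NAME from the five v24 stub texts as hypotheses**, by feeding the v23 census
(`…OfStubsAdmdefV23.anticyclotomicEisensteinDivisibility_of_admdefStubsV23`) with the Cassels–Tate conjunct supplied from the tree and the two anchor texts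
unfolded from the by-name constants (δ).  CONDITIONAL (audit `proof.conditional`); BSD / the crux / (Anch)_FW / (Anch)_¬FW / (γ′)_NP,Z are NOT proved here
(`--supports stmt-BirchSwinnertonDyer-20727`).
[cite: CastellaEtAl2025, Thm. 7.4, (7.2), Thm. 7.5, Thm. 7.6, §7.4 (arXiv:2308.10474v2 pp. 30–33)] [cite: FouquetWan2021, Thm. 5.1, Cor. 1.10 (arXiv:2107.13726v3 p. 53)]
[cite: WZhang2014, Prop. 5.4, Lemma 7.3, Thm. 9.1 (proof)] [cite: Howard2006, Thm. 3.2.3 (c)] [cite: MorganSmith2021CTP, §5 Thm. 5.10] [cite: MilneADT2006, Ch. I §6 Thm. 6.13]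
-/

-- D-0017: single-problem summit, the namespace repeats the problem name by design.
set_option linter.dupNamespace false
set_option autoImplicit false

noncomputable section

open scoped Classical NumberField

open NumberField IsDedekindDomain Field
  Literature.NumberTheory.EllipticCurves Literature.NumberTheory.EllipticCurves.ModularForms
  Literature.NumberTheory.EllipticCurves.Rank1Residual Literature.NumberTheory.EllipticCurves.Castella2018
  Literature.NumberTheory.EllipticCurves.CastellaWan2024 Literature.NumberTheory.GaloisRepresentations
  Literature.NumberTheory.EllipticCurves.YanZhu2026 Literature.NumberTheory.Automorphic
  Summit.BirchSwinnertonDyer.Rank1Residual.X11b Summit.BirchSwinnertonDyer.Rank1Residual.X11b.Halves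
  Summit.BirchSwinnertonDyer.BirchSwinnertonDyer.Theorems
open Literature.NumberTheory.EllipticCurves.AcSigned Literature.NumberTheory.EllipticCurves.CastellaHsuKunduLeeLiu2025
  Literature.NumberTheory.EllipticCurves.BertoliniDarmon2005 Literature.NumberTheory.EllipticCurves.IwasawaDual
open WeierstrassCurve (geomTorsion)
namespace Summit.BirchSwinnertonDyer.BirchSwinnertonDyer.Theorems.SignedBaseChangeAcDivOfStubsAdmdefV24

open Summit.BirchSwinnertonDyer.BirchSwinnertonDyer.Theses.SignedBaseChange
open Summit.BirchSwinnertonDyer.BirchSwinnertonDyer.Theorems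
open Summit.BirchSwinnertonDyer.BirchSwinnertonDyer.Theorems.GenusExact.CasselsTatePTcReal

/-- **Cassels–Tate over every number field, route-independently** (the dropped cite conjunct (12) of v23, now a tree theorem): the levelwise Cassels–Tate
assembly modulo a theta datum fed with the even-level theta datum (Morgan–Smith 2021 §5). [cite: MorganSmith2021CTP, §5 Thm. 5.10]
[cite: MilneADT2006, Ch. I §6 Thm. 6.13 (a)(b)] [cite: Cassels1962ArithmeticIV, §1] -/
theorem casselsTate_allFields : ∀ (K : Type) [Field K] [NumberField K], WeierstrassCurve.exists_casselsTate_pairing (K := K) :=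
  fun K _ _ ↦ exists_casselsTate_pairing_of_levelThetaDatum (K := K)
    fun V _ k hk _ e hμ hadd₁ hadd₂ _hgal halt _hnd =>
      ⟨levelThetaDatumEven V (2 ^ k) e hμ hadd₁ hadd₂ halt (Nat.even_pow.mpr ⟨even_two, hk.ne'⟩)⟩

/-- **The crux BY NAME from the five v24 stub texts** (cite stub ×15 · S1∣ at `p ∣ h_K` · (Anch)_FW BY NAME · (Anch)_¬FW = item 33118 BY NAME · (γ′)_NP,Z):
the v23 census with conjunct (12) from the tree (`casselsTate_allFields`) and the anchor texts unfolded from the `…DefiniteAnchorDefs` constants.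
CONDITIONAL on the displayed texts. [cite: CastellaEtAl2025, Thm. 7.4, Thm. 7.5, Thm. 7.6, §7.4] [cite: FouquetWan2021, Thm. 5.1, Cor. 1.10]
[cite: WZhang2014, Thm. 9.1 (proof), Lemma 7.3] [cite: Howard2006, Thm. 3.2.3 (c)] -/
theorem anticyclotomicEisensteinDivisibility_of_admdefStubsV24
    (hF : (Literature.NumberTheory.EllipticCurves.YanZhu2026.thm42_XGr₂_isTorsion_charIdeal_le_greenbergAnyRoot ∧
      Literature.NumberTheory.EllipticCurves.YanZhu2026.thm47_ord_localised_iff_greenbergAnyRoot_localised_guarded ∧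
      Literature.NumberTheory.EllipticCurves.YanZhu2026.thm33_exists_isHidaRankinLFunction) ∧
    (∀ (W : WeierstrassCurve ℚ) [W.IsGloballyMinimal] (K : Type) [Field K] [NumberField K] (p : ℕ) [Fact p.Prime]
      (κ : Literature.NumberTheory.EllipticCurves.ZpExtension K p) (𝔭 𝔭' : IsDedekindDomain.HeightOneSpectrum (NumberField.RingOfIntegers K)),
      Literature.NumberTheory.EllipticCurves.AcSigned.longoVigni2019_thm14_signedSelmerDual_rank_one W K p κ 𝔭 𝔭') ∧
    (∀ (N : ℕ) [NeZero N] (W : WeierstrassCurve ℚ) [W.IsGloballyMinimal] (K : Type) [Field K] [NumberField K] (p : ℕ) [Fact p.Prime]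
      (κ : Literature.NumberTheory.EllipticCurves.ZpExtension K p) (𝔭 𝔭' : IsDedekindDomain.HeightOneSpectrum (NumberField.RingOfIntegers K)),
      Literature.NumberTheory.EllipticCurves.AcSigned.castellaWan2024_proofThm68_transferInputs N W K p κ 𝔭 𝔭') ∧
    Literature.NumberTheory.EllipticCurves.BertoliniLongoVenerucci2026.thmA_castellaWan_thm68_exists_isCWBDPLFunction_charIdeal_map_le_rat ∧
    Literature.NumberTheory.IwasawaTheory.Greenberg2016.prop411_selmer_isAlmostDivisible ∧
    Literature.NumberTheory.EllipticCurves.BurungaleCastellaSkinner2025.proofProp422_span_minus_eq_span_bdp_goodReduction ∧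
    Literature.NumberTheory.EllipticCurves.BurungaleCastellaSkinner2025.prop422_exists_isBDPLFunction_mu_eq_zero ∧
    Literature.NumberTheory.EllipticCurves.CastellaHsuKunduLeeLiu2025.thm71_cor72_exists_isCWBDPLFunction_charIdeal_map_le_rat ∧
    (∀ (N : ℕ) [NeZero N] (W : WeierstrassCurve ℚ) [W.IsGloballyMinimal] (K : Type) [Field K] [NumberField K] (p : ℕ) [Fact p.Prime]
      (κ : Literature.NumberTheory.EllipticCurves.ZpExtension K p) (𝔭 𝔭' : IsDedekindDomain.HeightOneSpectrum (NumberField.RingOfIntegers K)),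
      Literature.NumberTheory.EllipticCurves.AcSigned.castellaWan2024_lemma67_finrank_torsionCharIdeal N W K p κ 𝔭 𝔭') ∧
    (∀ (N : ℕ) [NeZero N] (W : WeierstrassCurve ℚ) [W.IsGloballyMinimal] (K : Type) [Field K] [NumberField K] (p : ℕ) [Fact p.Prime]
      (κ : Literature.NumberTheory.EllipticCurves.ZpExtension K p) (𝔭 𝔭' : IsDedekindDomain.HeightOneSpectrum (NumberField.RingOfIntegers K)),
      Literature.NumberTheory.EllipticCurves.AcSigned.castellaWan2024_proofThm68_selmerRel_le_selmerSgn N W K p κ 𝔭 𝔭') ∧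
    (∀ (N : ℕ) [NeZero N] (W : WeierstrassCurve ℚ) [W.IsGloballyMinimal] (K : Type) [Field K] [NumberField K] (p : ℕ) [Fact p.Prime]
      (κ : Literature.NumberTheory.EllipticCurves.ZpExtension K p) (𝔭 𝔭' : IsDedekindDomain.HeightOneSpectrum (NumberField.RingOfIntegers K)),
      Literature.NumberTheory.EllipticCurves.CastellaHsuKunduLeeLiu2025.thm75_howard_rank_one_sq_le_and_le_of_hasUnitLambda N W K p κ 𝔭 𝔭') ∧
    Literature.NumberTheory.EllipticCurves.dokchitser_selmerCorank_baseChange_mod_two_eq ∧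
    Literature.NumberTheory.EllipticCurves.CastellaHsuKunduLeeLiu2025.prop25_XAc_isTorsion ∧
    Literature.NumberTheory.EllipticCurves.DefiniteMultiplicityOne.kimOta2023_thm55_brandtEigenvector_modP_unique ∧
    Literature.NumberTheory.EllipticCurves.CastellaHsuKunduLeeLiu2025.thm74_eq72_exists_signedSystem_transferClass_dictionary)
    (hDvd : SignedTwoVariableInputs → Literature.NumberTheory.EllipticCurves.ModularForms.nonempty_modularParametrizationData → ∀ (W : WeierstrassCurve ℚ) [W.IsElliptic] [W.IsGloballyMinimal] (p : ℕ) [Fact p.Prime], 5 ≤ p → W.HasGoodReductionAtPrime p → W.frobeniusTrace p = 0 → Literature.NumberTheory.EllipticCurves.Rank1Residual.Surj W p → ∀ (K : Type) [Field K] [NumberField K] (ι : PadicAlgCl p ≃+* ℂ) (v vbar : IsDedekindDomain.HeightOneSpectrum (NumberField.RingOfIntegers K)) (κ₁ κ₂ : Literature.NumberTheory.EllipticCurves.ZpExtension K p) (γ₁ γ₂ : Field.absoluteGaloisGroup K) [Fact (Literature.NumberTheory.EllipticCurves.ZpExtension.IsTopGeneratorPair κ₁ κ₂ γ₁ γ₂)]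 [NeZero (NumberField.discr K).natAbs] (N : ℕ) [NeZero N] (f : CuspForm (CongruenceSubgroup.Gamma0 N) 2), Literature.NumberTheory.EllipticCurves.ModularForms.IsNewformOf W f → (N : ℤ) = W.conductorNorm ℤ → Literature.NumberTheory.EllipticCurves.IsImaginaryQuadratic K → ((Ideal.span {(p : ℤ)}).primesOver (NumberField.RingOfIntegers K)).ncard = 2 → ((p : ℕ) : NumberField.RingOfIntegers K) ∈ v.asIdeal → ((p : ℕ) : NumberField.RingOfIntegers K) ∈ vbar.asIdeal → vbar ≠ v → (∀ (w : NumberField.InfinitePlace K) (k : NumberField.RingOfIntegers K), k ∈ v.asIdeal ↔ ‖ι.symm (w.embedding (k : K))‖ < 1) → IsCoprime (N : ℤ) (NumberField.discr K) → (∀ ℓ : ℕ, ℓ.Prime → ℓ ∣ N → ((Ideal.span {(ℓ : ℤ)}).primesOver (NumberField.RingOfIntegers K)).ncard = 2) → Odd (NumberField.discr K) → NumberField.discr K ≠ -3 → κ₁.IsCyclotomic → κ₂.IsAnticyclotomic → p ∣ NumberField.classNumber K → (haveI : Fact (κ₂.IsTopGenerator γ₂) := ⟨Literature.NumberTheory.EllipticCurves.YanZhu2026.isTopGenerator_of_pair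 (κ₁ := κ₁) (γ₁ := γ₁)⟩; Module.IsTorsion (Literature.NumberTheory.EllipticCurves.IwasawaAlgebra p) (Literature.NumberTheory.EllipticCurves.Castella2018.AcSelmer.XAc (W.baseChange K) p κ₂ vbar ∅ γ₂)) → ∀ (ΩK : ℂ) (Ωp' : (Literature.NumberTheory.EllipticCurves.unrIntegers p)ˣ) (L : Literature.NumberTheory.EllipticCurves.UnrSeries p), ΩK ≠ 0 → Literature.NumberTheory.EllipticCurves.IsBDPLFunction ι v κ₂ γ₂ f ΩK ((Ωp' : Literature.NumberTheory.EllipticCurves.unrIntegers p) : PadicComplex p) L → ∀ J : ℤ_[p] →+* PadicComplexInt p, (∀ x : ℤ_[p], ((J x : PadicComplexInt p) : PadicComplex p) = ((x : ℚ_[p]) : PadicComplex p)) → ∀ (J₀ : Literature.NumberTheory.EllipticCurves.unrIntegers p →+* PadicComplexInt p), (∀ x : Literature.NumberTheory.EllipticCurves.unrIntegers p, ((J₀ x : PadicComplexInt p) : PadicComplex p) = (x : PadicComplex p)) → ∃ k : ℕ, ∀ y ∈ (haveI : Fact (κ₂.IsTopGenerator γ₂) := ⟨Literature.NumberTheory.EllipticCurves.YanZhu2026.isTopGenerator_of_pair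 (κ₁ := κ₁) (γ₁ := γ₁)⟩; Literature.NumberTheory.EllipticCurves.Castella2018.AcSelmer.XAc.charIdeal (W.baseChange K) p κ₂ vbar ∅ γ₂).map (PowerSeries.map J), PowerSeries.C (((p : ℕ) : PadicComplexInt p) ^ k) * y ∈ Ideal.span {PowerSeries.map J₀ L})
    (hAFW : Summit.BirchSwinnertonDyer.BirchSwinnertonDyer.Theorems.SignedBaseChangeDefiniteAnchorDefs.DefiniteAnchorFW)
    (hANFW : Summit.BirchSwinnertonDyer.BirchSwinnertonDyer.Theorems.SignedBaseChangeDefiniteAnchorDefs.DefiniteAnchorNonFW)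
    (hUZ : ∀ {p : ℕ} [Fact p.Prime] (ι : PadicAlgCl p ≃+* ℂ) (W : WeierstrassCurve ℚ) [W.IsElliptic]
      [W.IsGloballyMinimal] (K : Type) [Field K] [NumberField K]
      (𝔭 𝔭bar : HeightOneSpectrum (𝓞 K)) (κ : ZpExtension K p) (γ : absoluteGaloisGroup K)
      [Fact (κ.IsTopGenerator γ)] {N : ℕ} [NeZero N] {f : CuspForm (CongruenceSubgroup.Gamma0 N) 2}
      (_ : IsNewformOf W f),
      (N : ℤ) = W.conductorNorm ℤ → 5 ≤ p → W.HasGoodReductionAtPrime p → W.frobeniusTrace p = 0 →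
      Surj W p →
      IsImaginaryQuadratic K → ((Ideal.span {(p : ℤ)}).primesOver (𝓞 K)).ncard = 2 →
        ((p : ℕ) : 𝓞 K) ∈ 𝔭.asIdeal →
        (∀ (w : InfinitePlace K) (k : 𝓞 K), k ∈ 𝔭.asIdeal ↔ ‖ι.symm (w.embedding (k : K))‖ < 1) →
        ((p : ℕ) : 𝓞 K) ∈ 𝔭bar.asIdeal → 𝔭bar ≠ 𝔭 →
      (∀ ℓ : ℕ, ℓ.Prime → ℓ ∣ N → ((Ideal.span {(ℓ : ℤ)}).primesOver (𝓞 K)).ncard = 2) →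
      IsCoprime (N : ℤ) (NumberField.discr K) → ¬ p ∣ NumberField.classNumber K →
      -- cell γ′: NOT every `q ∣ N` has an inertia element moving a `p`-torsion point (some `q ∣ N` with `E[p]` unramified)
      ¬ (∀ q : ℕ, q.Prime → q ∣ N →
        ∃ v : HeightOneSpectrum (𝓞 ℚ), ((q : ℕ) : 𝓞 ℚ) ∈ v.asIdeal ∧
          ∃ 𝔓 ∈ v.primesAbove, ∃ σ ∈ 𝔓.inertia (absoluteGaloisGroup ℚ),
            ∃ P : W.geomTorsion (p : ℤ), σ • P ≠ P) →
      κ.IsAnticyclotomic →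
      -- (NP): the NON-PRIMITIVE locus — some pinned `+` tuple has bottom class invisible at every admissible Frobenius
      (∃ (ι : PadicAlgCl p ≃+* ℂ) (𝔭 𝔭bar : HeightOneSpectrum (𝓞 K)) (κ : ZpExtension K p) (γ : absoluteGaloisGroup K)
        (hγ : κ.IsTopGenerator γ) (h𝔭 : ((p : ℕ) : 𝓞 K) ∈ 𝔭.asIdeal) (hne : 𝔭bar ≠ 𝔭)
        (h𝔭ns : AcSigned.IsNonsplitIn κ 𝔭) (γ𝔭 : absoluteGaloisGroup (𝔭.adicCompletion K))
        (hγ𝔭 : κ (resGalOfEmb (closureEmb (K := K) (𝔭.adicCompletion K)) γ𝔭) = κ γ)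
        (ΩK : ℂ) (Ωp : (unrIntegers p)ˣ) (L : UnrSeries p)
        (z : AcSigned.selmerLambdaAdic (W.baseChange K) p κ γ (fun _ ↦ .sgn 1))
        (B : CastellaHsuKunduLeeLiu2025.SignedBipartiteSystem W K p κ),
        κ.IsAnticyclotomic ∧ (∀ (w : InfinitePlace K) (k : 𝓞 K), k ∈ 𝔭.asIdeal ↔ ‖ι.symm (w.embedding (k : K))‖ < 1) ∧
        ((p : ℕ) : 𝓞 K) ∈ 𝔭bar.asIdeal ∧ ΩK ≠ 0 ∧
        IsCWBDPLFunction ι 𝔭 κ γ f (NumberField.discr K) ΩK ((Ωp : unrIntegers p) : ℂ_[p]) L ∧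
        AcSigned.TransferInputs (W.baseChange K) p κ γ hγ 𝔭 h𝔭ns γ𝔭 hγ𝔭 𝔭bar (fun h ↦ hne h.symm) h𝔭 1 z L ∧
        CastellaHsuKunduLeeLiu2025.IsSignedBipartiteSystem W K p κ γ N 1 B ∧ B.IsLimitBaseClass z.1 ∧
        z.1 0 1 = 0) →
      ∃ (ΩK : ℂ) (Ωp : (unrIntegers p)ˣ) (L : UnrSeries p),
        ΩK ≠ 0 ∧
        IsCWBDPLFunction ι 𝔭 κ γ f (NumberField.discr K) ΩK ((Ωp : unrIntegers p) : ℂ_[p]) L ∧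
        ∀ (j : ℤ_[p] →+* unrIntegers p),
          (∀ x : ℤ_[p], ((j x : unrIntegers p) : ℂ_[p]) = algebraMap ℚ_[p] ℂ_[p] (x : ℚ_[p])) →
          ∃ k : ℕ,
            Ideal.span {PowerSeries.C ((p : unrIntegers p) ^ k)} *
                (Castella2018.AcSelmer.XAc.charIdeal (W.baseChange K) p κ 𝔭bar ∅ γ).map (PowerSeries.map j) ≤
              Ideal.span {L}) :
    Summit.BirchSwinnertonDyer.BirchSwinnertonDyer.Theses.SignedBaseChange.AnticyclotomicEisensteinDivisibility := by
  obtain ⟨hYZ, hLV, hTI, hBLV, hGr, hBCS1, hBCS2, hCH71, hCW67, hCWrel, hCH75, hDD, hP25, hM1, hP01⟩ := hF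
  exact SignedBaseChangeAcDivOfStubsAdmdefV23.anticyclotomicEisensteinDivisibility_of_admdefStubsV23
    ⟨hYZ, hLV, hTI, hBLV, hGr, hBCS1, hBCS2, hCH71, hCW67, hCWrel, hCH75, casselsTate_allFields, hDD, hP25, hM1, hP01⟩ hDvd hAFW hANFW hUZ

end Summit.BirchSwinnertonDyer.BirchSwinnertonDyer.Theorems.SignedBaseChangeAcDivOfStubsAdmdefV24

end
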